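/-
Origin: expansion seat `planner-pub-hodgecm-toy2-g2-0`, handover 2026-08-18 (`HOME/pub-hodgecm-toy2-g2/lean/Toy2g2/ToyPerL.lean`, md5 7f42efa8, 106 lines);
landed by the gen-6 packager in gate run 22 as `HodgeCM/Model/ToyPerL.lean` (import ^import Toy2g2\.PerLInhabited\b→import HodgeCM.Model.PerLInhabited ×1).
-/
/-
Copyright: pub-hodgecm formalisation cell (harness21, 2026). New file (not vendored).
Origin: HOME/pub-hodgecm-toy2-g2/lean/Toy2g2/ToyPerL.lean (WIP module `Toy2g2.ToyPerL`; intended final place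
`HodgeCM/Model/ToyPerL.lean` = module `HodgeCM.Model.ToyPerL`, CONTRIBUTING §3 L5) (seat planner-pub-hodgecm-toy2-g2-0,
consistency seat 2 gen 2: the two consistency seats combined — what holds and what fails in the toy universe).
-/
import Summits.HodgeConjecture.HodgeCM.Model.Toy.Toy
import Summits.HodgeConjecture.HodgeCM.Model.PerLInhabited

/-!
# The toy universe decides every named statement except the two reduction inputs

`HodgeCM.Toy.toyModel` (seat toy, run 21: 27 of the 28 model facts outright, M28 under the typed input `h28`) is its own
period-free shadow (`tr = 0`), so the results of `HodgeCM/Model/{PeriodFree,Inhabited,PerLInhabited}.lean` apply to it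
verbatim.  Together with "algebraic := Hodge" (the toy's definition of `alg`):

* HOLD in `toyModel`: `HC X` for every variety (hence `HC_CM`, `FaceReduction`, `Lemma81`), `W_RK4`.
* FAIL in `toyModel`: `RealisationExistsFace`, `PeriodThmF` (rfwf Thm 4.1), `RealisationExistsPerL`, `PerL` (W_per^L),
  `PerL44` (PerL Thm 4.4) — the last three by `HodgeCM.perLHypothesesInhabited`.

So ONE universe satisfies the 28 facts (granted `h28`), both conclusions `HC_CM` / `W_RK4` of the reductions, and the
NEGATIONS of all five realisation-side statements: none of `PerL`, `PerL44`, `PeriodThmF`, `RealisationExistsPerL`,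
`RealisationExistsFace` is a consequence of `ModelAxioms ∧ HC_CM ∧ W_RK4` (relative to `h28` only), and none is
refutable from them either unless the intended model refutes it.  (`PohlmannSpan` and `Qw8Sufficiency` are true in the
toy universe as well — Pohlmann's mechanism on the eigen-monomial basis — but that is not formalised here.)
-/

noncomputable section

namespace HodgeCM.Toy

open Literature.AlgebraicGeometry.Motives

/-- The toy universe is its own period-free shadow. -/
theorem toyModelWith_periodFree (D : HodgeData) : (toyModelWith D).periodFree = toyModelWith D := rfl

/-- (Ported verbatim from the HodgeCMPerL package; no docstring in the source.) -/
theorem toyModel_periodFree : toyModel.periodFree = toyModel := rfl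

/-! ### What holds: algebraic = Hodge -/

/-- Every variety of the toy universe satisfies `HC` (by the definition of `alg`). -/
theorem toyModelWith_hc (D : HodgeData) (X : (toyModelWith D).Var) : (toyModelWith D).HC X :=
  fun p => le_of_eq (hodgeClassesOf_eq X p)

/-- (Ported verbatim from the HodgeCMPerL package; no docstring in the source.) -/
theorem toyModelWith_hc_cm (D : HodgeData) : (toyModelWith D).HC_CM := fun X _ => toyModelWith_hc D X

/-- (Ported verbatim from the HodgeCMPerL package; no docstring in the source.) -/
theorem toyModelWith_faceReduction (D : HodgeData) : (toyModelWith D).FaceReduction :=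
  fun _ _ _ _ _ _ => toyModelWith_hc D _

/-- (Ported verbatim from the HodgeCMPerL package; no docstring in the source.) -/
theorem toyModelWith_lemma81 (D : HodgeData) : (toyModelWith D).Lemma81 := fun _ => toyModelWith_hc_cm D

/-- `W_RK4` holds in the toy universe: the Weil face lines consist of Hodge classes (M16, `fact_weilLine_hodge`),
which are algebraic by definition. -/
theorem toyModelWith_w_rk4 (D : HodgeData) : (toyModelWith D).W_RK4 :=
  fun F _ _ f => (fact_weilLine_hodge D F f).trans (le_of_eq (hodgeClassesOf_eq _ 2))

/-- (Ported verbatim from the HodgeCMPerL package; no docstring in the source.) -/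
theorem toyModel_hc_cm : toyModel.HC_CM := toyModelWith_hc_cm _
/-- (Ported verbatim from the HodgeCMPerL package; no docstring in the source.) -/
theorem toyModel_w_rk4 : toyModel.W_RK4 := toyModelWith_w_rk4 _
/-- (Ported verbatim from the HodgeCMPerL package; no docstring in the source.) -/
theorem toyModel_faceReduction : toyModel.FaceReduction := toyModelWith_faceReduction _
/-- (Ported verbatim from the HodgeCMPerL package; no docstring in the source.) -/
theorem toyModel_lemma81 : toyModel.Lemma81 := toyModelWith_lemma81 _

/-! ### What fails: the five realisation-side statements -/

/-- (Ported verbatim from the HodgeCMPerL package; no docstring in the source.) -/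
theorem toyModelWith_not_perL (D : HodgeData) : ¬ (toyModelWith D).PerL :=
  toyModelWith_periodFree D ▸ (toyModelWith D).not_perL_periodFree

/-- (Ported verbatim from the HodgeCMPerL package; no docstring in the source.) -/
theorem toyModelWith_not_perL44 (D : HodgeData) : ¬ (toyModelWith D).PerL44 :=
  toyModelWith_periodFree D ▸ (toyModelWith D).not_perL44_periodFree

/-- (Ported verbatim from the HodgeCMPerL package; no docstring in the source.) -/
theorem toyModelWith_not_realisationExistsPerL (D : HodgeData) : ¬ (toyModelWith D).RealisationExistsPerL :=
  toyModelWith_periodFree D ▸ (toyModelWith D).not_realisationExistsPerL_periodFree (fact_pull_hodge D)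

/-- (Ported verbatim from the HodgeCMPerL package; no docstring in the source.) -/
theorem toyModelWith_not_periodThmF (D : HodgeData) : ¬ (toyModelWith D).PeriodThmF :=
  toyModelWith_periodFree D ▸ (toyModelWith D).not_periodThmF_periodFree

/-- (Ported verbatim from the HodgeCMPerL package; no docstring in the source.) -/
theorem toyModelWith_not_realisationExistsFace (D : HodgeData) : ¬ (toyModelWith D).RealisationExistsFace :=
  toyModelWith_periodFree D ▸ (toyModelWith D).not_realisationExistsFace_periodFree (fact_pull_hodge D)

/-- (Ported verbatim from the HodgeCMPerL package; no docstring in the source.) -/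
theorem toyModel_not_perL : ¬ toyModel.PerL := toyModelWith_not_perL _
/-- (Ported verbatim from the HodgeCMPerL package; no docstring in the source.) -/
theorem toyModel_not_perL44 : ¬ toyModel.PerL44 := toyModelWith_not_perL44 _
/-- (Ported verbatim from the HodgeCMPerL package; no docstring in the source.) -/
theorem toyModel_not_realisationExistsPerL : ¬ toyModel.RealisationExistsPerL := toyModelWith_not_realisationExistsPerL _
/-- (Ported verbatim from the HodgeCMPerL package; no docstring in the source.) -/
theorem toyModel_not_periodThmF : ¬ toyModel.PeriodThmF := toyModelWith_not_periodThmF _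
/-- (Ported verbatim from the HodgeCMPerL package; no docstring in the source.) -/
theorem toyModel_not_realisationExistsFace : ¬ toyModel.RealisationExistsFace :=
  toyModelWith_not_realisationExistsFace _

/-- **Summary.** Granted the typed input `h28` (M28 in the toy universe), one universe satisfies the 28 model facts,
`HC_CM`, `W_RK4`, `FaceReduction`, `Lemma81`, and the negations of `PerL`, `PerL44`, `PeriodThmF`,
`RealisationExistsPerL`, `RealisationExistsFace` (hence `¬ OpenInputs`). -/
theorem toyModel_decides (h28 : toyModel.Fact_algDuality) :
    toyModel.ModelAxioms ∧ toyModel.HC_CM ∧ toyModel.W_RK4 ∧ toyModel.FaceReduction ∧ toyModel.Lemma81 ∧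
      ¬ toyModel.PerL ∧ ¬ toyModel.PerL44 ∧ ¬ toyModel.PeriodThmF ∧
      ¬ toyModel.RealisationExistsPerL ∧ ¬ toyModel.RealisationExistsFace ∧ ¬ toyModel.OpenInputs :=
  ⟨toyModel_axioms h28, toyModel_hc_cm, toyModel_w_rk4, toyModel_faceReduction, toyModel_lemma81,
    toyModel_not_perL, toyModel_not_perL44, toyModel_not_periodThmF, toyModel_not_realisationExistsPerL,
    toyModel_not_realisationExistsFace, toyModel_not_openInputs'⟩

/-- The absolute form of `HodgeCM.exists_model_not_perL`, relative to `h28` only. -/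
theorem exists_model_not_perL (h28 : toyModel.Fact_algDuality) :
    ∃ U : Universe, U.ModelAxioms ∧ U.HC_CM ∧ U.W_RK4 ∧ ¬ U.PerL ∧ ¬ U.PerL44 ∧ ¬ U.PeriodThmF ∧
      ¬ U.RealisationExistsPerL ∧ ¬ U.RealisationExistsFace :=
  ⟨toyModel, toyModel_axioms h28, toyModel_hc_cm, toyModel_w_rk4, toyModel_not_perL, toyModel_not_perL44,
    toyModel_not_periodThmF, toyModel_not_realisationExistsPerL, toyModel_not_realisationExistsFace⟩

end HodgeCM.Toy

end
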